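import Literature.Analysis.Hypoelliptic.ChartData
import Literature.Analysis.Hypoelliptic.KeyIdentity
import Literature.Analysis.Distribution.SmoothLocality
import HarnessLib

/-!
# The chart on the `x`-side: the flat operator is Hörmander's transpose, and the hypothesis of
the key identity

Analysis/Hypoelliptic support file serving the discharge of
`Literature.Analysis.Distribution.Hormander1967_thm11`.

For a chart `C : Chart V K` built from the pushed-forward data of Hörmander's operator on `E`
(`C.XV i = T_* X_i`, `C.XV0 = T_* X₀`, `C.cV = c ∘ T⁻¹`) and the `x`-side link `C.xl T` of its
flat data:

* `Chart.PfC_eq_PfV`: `PfC h x = PfV (h ∘ T⁻¹) (T x)`;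
* `Chart.PfC_ofReal`: `PfC φ = ᵗP φ` for real test functions `φ` supported in the chart
  `T⁻¹(ball y₀ δ)`;
* **`Chart.hPu`**: if `P u` is the smooth function `f` on `U` (`ImageIsSmoothOn`), then for
  cutoffs `ζ` (supported in `U` and in the chart) and `ζ' = 1` on `tsupport ζ`:
  `uC u ζ' (PfC (ζ g)) = ∫ f ζ g dμ` — the hypothesis of `KeyIdentity`.

## References

* L. Hörmander, Acta Math. 119 (1967), §3 (folklore bookkeeping).
-/

noncomputable section

open MeasureTheory Set Filter Function SchwartzMap VectorField Metric TopologicalSpace Distributions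
open scoped Topology ComplexConjugate InnerProductSpace BigOperators ContDiff

namespace Literature.Analysis.Hypoelliptic

open Literature.Analysis.Distribution

variable {E : Type*} [NormedAddCommGroup E] [NormedSpace ℝ E]
variable {V : Type*} [NormedAddCommGroup V] [InnerProductSpace ℝ V] [FiniteDimensional ℝ V]
  [MeasurableSpace V] [BorelSpace V]


/-! ### A cutoff times a function smooth on an open set -/

/-- A cutoff supported inside a set where `g` is smooth, times `g`, is smooth. [folklore] -/
theorem contDiff_cutoff_mul' {ρ g : E → ℝ} (hρ : ContDiff ℝ ∞ ρ) {U : Set E} (hsupp : tsupport ρ ⊆ U)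
    (hg : ∀ y ∈ U, ContDiffAt ℝ ∞ g y) : ContDiff ℝ ∞ (fun y => ρ y * g y) := by
  refine contDiff_iff_contDiffAt.2 fun y => ?_
  by_cases hy : y ∈ tsupport ρ
  · exact hρ.contDiffAt.mul (hg y (hsupp hy))
  · have hev : (fun z => ρ z * g z) =ᶠ[𝓝 y] fun _ => 0 := by
      have h0 : ρ =ᶠ[𝓝 y] 0 := notMem_tsupport_iff_eventuallyEq.1 hy
      filter_upwards [h0] with z hz
      simp [hz]
    exact (contDiffAt_const (c := (0 : ℝ))).congr_of_eventuallyEq hev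

/-! ### `x`-side data of coefficient families -/

namespace CoefFam

variable (F : CoefFam V (Module.finrank ℝ V)) (T : E ≃L[ℝ] V)

/-- The `x`-side data of a coefficient family. [folklore] -/
def xdata : F.toFlat.XData FlatHData.bas T where
  a := fun k x => (F.a k (T x)).re
  b := F.a
  smooth := fun k => Complex.reCLM.contDiff.comp (((F.a k).smooth ⊤).comp (T : E →L[ℝ] V).contDiff)
  link := fun k x => by
    have := F.real k (T x)
    apply Complex.ext <;> simp [Complex.conj_eq_iff_im.1 this]
  theta := fun _ => rfl
  creal := fun _ => Complex.ofReal_im _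

/-- The full `x`-side coefficient is `Re (c_k + a_k) ∘ T`. [folklore] -/
theorem xdata_xa (k : Fin (Module.finrank ℝ V)) (x : E) : ((F.xdata T).xa k x : ℂ) = F.fn k (T x) := by
  simp only [FlatField.XData.xa, xdata, toFlat, fn, Complex.ofReal_re]
  push_cast
  congr 1
  have := F.real k (T x)
  apply Complex.ext <;> simp [Complex.conj_eq_iff_im.1 this]

/-- **`fieldC` of the `x`-side data is `♭` on the `V`-side**:
`fieldC xa (T⁻¹ e) h x = ♭ (h ∘ T⁻¹) (T x)`. [folklore] -/
theorem fieldC_xdata {h : E → ℂ} (hh : ContDiff ℝ ∞ h) (x : E) :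
    fieldC (F.xdata T).xa (frameDir T FlatHData.bas) h x =
      flatC FlatHData.bas F.fn (fun y => h (T.symm y)) (T x) := by
  unfold fieldC flatC
  refine Finset.sum_congr rfl fun k _ => ?_
  simp only [derivC, frameDir, pd_apply]
  set G : V → ℂ := fun y => F.fn k y * h (T.symm y) with hG
  have hGs : ContDiff ℝ ∞ G := (F.smooth k).mul (hh.comp T.symm.contDiff)
  have e : mulC ((F.xdata T).xa k) h = fun x => G (T x) := by
    ext x; simp only [mulC, hG, xdata_xa, ContinuousLinearEquiv.symm_apply_apply]
  rw [e, show (fun x => G (T x)) = G ∘ (T : E → V) from rfl,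
    fderiv_comp x ((hGs.differentiable (by simp)) _) T.differentiableAt]
  simp [ContinuousLinearEquiv.fderiv]

end CoefFam

/-! ### The `x`-side link of a chart -/

namespace Chart

variable {K : ℕ} (C : Chart V K) (T : E ≃L[ℝ] V)

/-- **The `x`-side link of the chart's flat data.** [folklore] -/
def xl : C.g.fd.XLink T where
  xX := fun j => (C.fams j).xdata T
  xX0 := C.fam0.xdata T
  aC := fun x => (C.bC (T x)).re
  bC := C.bC
  smoothC := Complex.reCLM.contDiff.comp ((C.bC.smooth ⊤).comp (T : E →L[ℝ] V).contDiff)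
  linkC := fun x => by rw [Chart.bC_apply]; simp
  thetaC := rfl
  crealC := by show (0 : ℂ).im = 0; simp

/-- `D_j h x = ♭_j (h ∘ T⁻¹) (T x)`. [folklore] -/
theorem xl_D (j : Fin (K + (Module.finrank ℝ V))) {h : E → ℂ} (hh : ContDiff ℝ ∞ h) (x : E) :
    (C.xl T).D j h x = flatC FlatHData.bas (C.fams j).fn (fun y => h (T.symm y)) (T x) :=
  (C.fams j).fieldC_xdata T hh x

/-- `D₀ h x = ♭₀ (h ∘ T⁻¹) (T x)`. [folklore] -/
theorem xl_D0 {h : E → ℂ} (hh : ContDiff ℝ ∞ h) (x : E) :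
    (C.xl T).D0 h x = flatC FlatHData.bas C.fam0.fn (fun y => h (T.symm y)) (T x) :=
  C.fam0.fieldC_xdata T hh x

/-- **`PfC h x = PfV (h ∘ T⁻¹) (T x)`.** [folklore] -/
theorem PfC_eq_PfV {h : E → ℂ} (hh : ContDiff ℝ ∞ h) (x : E) :
    (C.xl T).PfC h x = C.PfV (fun y => h (T.symm y)) (T x) := by
  unfold FlatHData.XLink.PfC Chart.PfV
  have h1 : ∀ j, (C.xl T).D j ((C.xl T).D j h) x =
      flatC FlatHData.bas (C.fams j).fn (flatC FlatHData.bas (C.fams j).fn fun y => h (T.symm y)) (T x) := by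
    intro j
    rw [C.xl_D T j ((C.xl T).contDiff_D j hh)]
    congr 1
    ext y
    rw [C.xl_D T j hh, ContinuousLinearEquiv.apply_symm_apply]
  have h2 : ((C.xl T).cfull x : ℂ) = C.bC (T x) := by
    simp only [FlatHData.XLink.cfull, xl, Chart.bC_apply, Complex.ofReal_re]
    push_cast
    show ((C.g.fd.cC).re : ℂ) + _ = _
    simp [GData.fd]
  rw [Finset.sum_congr rfl fun j _ => h1 j, C.xl_D0 T hh, h2]
  simp only [ContinuousLinearEquiv.symm_apply_apply]
  rfl

/-! ### `PfC` on real test functions supported in the chart is `ᵗP` -/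

variable {ι : Type*} [Fintype ι] {X₀ : E → E} {X : ι → E → E} {c : E → ℝ}

/-- A differential operator kills functions vanishing near the point. [folklore] -/
theorem PfC_eq_zero_of_eventuallyEq {h : E → ℂ} (hh : ContDiff ℝ ∞ h) {x : E} (hx : h =ᶠ[𝓝 x] 0) :
    (C.xl T).PfC h x = 0 := by
  rw [C.PfC_eq_PfV T hh]
  -- `h ∘ T⁻¹` vanishes near `T x`, hence so do all flat derivatives
  have hH : (fun y => h (T.symm y)) =ᶠ[𝓝 (T x)] 0 := by
    have : Tendsto (T.symm : V → E) (𝓝 (T x)) (𝓝 x) := by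
      have := T.symm.continuous.tendsto (T x); rwa [ContinuousLinearEquiv.symm_apply_apply] at this
    exact this.eventually hx |>.mono fun y hy => hy
  have hflat : ∀ {a : Fin (Module.finrank ℝ V) → V → ℂ} {H : V → ℂ} {y : V}, H =ᶠ[𝓝 y] 0 → flatC FlatHData.bas a H =ᶠ[𝓝 y] 0 := by
    intro a H y hHy
    filter_upwards [hHy.eventuallyEq_nhds] with z hz
    simp only [flatC, Pi.zero_apply]
    refine Finset.sum_eq_zero fun l _ => ?_
    rw [pd_apply]
    have : (fun w => a l w * H w) =ᶠ[𝓝 z] 0 := by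
      filter_upwards [hz] with w hw; simp [hw]
    rw [this.fderiv_eq]; simp
  unfold Chart.PfV
  have e1 : ∀ j, flatC FlatHData.bas (C.fams j).fn (flatC FlatHData.bas (C.fams j).fn fun y => h (T.symm y)) (T x) = 0 :=
    fun j => (hflat (hflat hH)).self_of_nhds
  have e2 : flatC FlatHData.bas C.fam0.fn (fun y => h (T.symm y)) (T x) = 0 := (hflat hH).self_of_nhds
  have hx0 : h x = 0 := hx.self_of_nhds
  simp [e1, e2, hx0]

/-- **`PfC φ = ᵗP φ`** for real smooth `φ` supported in the chart, when the chart's data are the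
pushforwards of `(X₀, X, c)` (reindexed by `eK`). [folklore] -/
theorem PfC_ofReal [FiniteDimensional ℝ E] (eK : ι ≃ Fin K) (hXV : ∀ i, C.XV i = push T (X (eK.symm i)))
    (hXV0 : C.XV0 = push T X₀) (hcV : C.cV = fun y => c (T.symm y))
    (hX₀ : ContDiff ℝ ∞ X₀) (hX : ∀ j, ContDiff ℝ ∞ (X j))
    {φ : E → ℝ} (hφ : ContDiff ℝ ∞ φ) (hsupp : tsupport φ ⊆ T ⁻¹' ball C.y₀ C.δ) (x : E) :
    (C.xl T).PfC (fun x => (φ x : ℂ)) x = (hormanderTranspose X₀ X c φ x : ℂ) := by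
  by_cases hx : x ∈ tsupport φ
  · have hTx : T x ∈ ball C.y₀ C.δ := hsupp hx
    rw [C.PfC_eq_PfV T (h := fun x => (φ x : ℂ)) (Complex.ofRealCLM.contDiff.comp hφ)]
    have e1 : (fun y => ((φ (T.symm y) : ℝ) : ℂ)) = fun y => (((fun y => φ (T.symm y)) y : ℝ) : ℂ) := rfl
    rw [e1, C.PfV_ofReal (F := fun y => φ (T.symm y)) (hφ.comp T.symm.contDiff) hTx]
    congr 1
    have e2 : φ = fun x => (fun y => φ (T.symm y)) (T x) := by ext x; simp
    conv_rhs => rw [e2]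
    rw [hormanderTranspose_comp T hX₀ hX c (F := fun y => φ (T.symm y)) (hφ.comp T.symm.contDiff) x, hXV0, hcV]
    -- reindex the sum over the fields along `eK`
    unfold hormanderTranspose
    congr 2
    simp only [hXV]
    exact Fintype.sum_equiv eK.symm _ _ fun i => rfl
  · -- both sides vanish
    have h0 : (fun x => ((φ x : ℝ) : ℂ)) =ᶠ[𝓝 x] 0 := by
      filter_upwards [notMem_tsupport_iff_eventuallyEq.1 hx] with z hz; simp [hz]
    rw [C.PfC_eq_zero_of_eventuallyEq T (h := fun x => (φ x : ℂ)) (Complex.ofRealCLM.contDiff.comp hφ) h0]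
    have : hormanderTranspose X₀ X c φ x = 0 :=
      image_eq_zero_of_notMem_tsupport fun h => hx (tsupport_hormanderTranspose_subset X₀ X c φ h)
    rw [this]; simp

/-! ### Linearity of `PfC` -/

/-- `fieldC` is homogeneous on smooth functions. [folklore] -/
theorem fieldC_const_mul {ι' : Type*} [Fintype ι'] {xa : ι' → E → ℝ} (hxa : ∀ k, ContDiff ℝ ∞ (xa k))
    (v : ι' → E) (a : ℂ) {h : E → ℂ} (hh : ContDiff ℝ ∞ h) :
    fieldC xa v (fun x => a * h x) = fun x => a * fieldC xa v h x := by
  ext x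
  unfold fieldC
  rw [Finset.mul_sum]
  refine Finset.sum_congr rfl fun k _ => ?_
  simp only [derivC]
  have e : mulC (xa k) (fun x => a * h x) = fun y => a * mulC (xa k) h y := by
    ext y; simp only [mulC]; ring
  rw [e, fderiv_const_mul ((contDiff_mulC (hxa k) hh).differentiable (by simp)).differentiableAt]
  simp

/-- `PfC` is additive on smooth functions. [folklore] -/
theorem PfC_add {f g : E → ℂ} (hf : ContDiff ℝ ∞ f) (hg : ContDiff ℝ ∞ g) :
    (C.xl T).PfC (fun x => f x + g x) = fun x => (C.xl T).PfC f x + (C.xl T).PfC g x := by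
  ext x
  simp only [FlatHData.XLink.PfC]
  have hD : ∀ j, (C.xl T).D j (fun x => f x + g x) = fun x => (C.xl T).D j f x + (C.xl T).D j g x :=
    fun j => (C.xl T).D_add j hf hg
  have hDD : ∀ j, (C.xl T).D j ((C.xl T).D j fun x => f x + g x) x =
      (C.xl T).D j ((C.xl T).D j f) x + (C.xl T).D j ((C.xl T).D j g) x := by
    intro j
    rw [hD j, (C.xl T).D_add j ((C.xl T).contDiff_D j hf) ((C.xl T).contDiff_D j hg)]
  have hD0 : (C.xl T).D0 (fun x => f x + g x) x = (C.xl T).D0 f x + (C.xl T).D0 g x :=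
    congrFun (fieldC_add (C.xl T).xX0.contDiff_xa _ hf hg) x
  simp only [hDD, hD0, Finset.sum_add_distrib]
  ring

/-- `PfC` is homogeneous on smooth functions. [folklore] -/
theorem PfC_const_mul (a : ℂ) {h : E → ℂ} (hh : ContDiff ℝ ∞ h) :
    (C.xl T).PfC (fun x => a * h x) = fun x => a * (C.xl T).PfC h x := by
  ext x
  simp only [FlatHData.XLink.PfC]
  have hD : ∀ j, (C.xl T).D j (fun x => a * h x) = fun x => a * (C.xl T).D j h x :=
    fun j => fieldC_const_mul ((C.xl T).xX j).contDiff_xa _ a hh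
  have hDD : ∀ j, (C.xl T).D j ((C.xl T).D j fun x => a * h x) x = a * (C.xl T).D j ((C.xl T).D j h) x := by
    intro j
    rw [hD j, show (C.xl T).D j (fun x => a * (C.xl T).D j h x) = fun x => a * (C.xl T).D j ((C.xl T).D j h) x from
      fieldC_const_mul ((C.xl T).xX j).contDiff_xa _ a ((C.xl T).contDiff_D j hh)]
  have hD0 : (C.xl T).D0 (fun x => a * h x) x = a * (C.xl T).D0 h x :=
    congrFun (fieldC_const_mul (C.xl T).xX0.contDiff_xa _ a hh) x
  simp only [hDD, hD0, ← Finset.mul_sum]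
  ring

/-! ### The hypothesis of the key identity -/

variable {Ω' : Opens E}

/-- `uC u ζ' (φ : real) = u (ζ' φ)` for a real smooth `φ`. [folklore] -/
theorem uC_ofReal (u : 𝓓'(Ω', ℝ)) (ζ' : 𝓓(Ω', ℝ)) {φ : E → ℝ} (hφ : ContDiff ℝ ∞ φ) :
    uC u ζ' (fun x => (φ x : ℂ)) = (u (mulSmooth ζ' φ hφ) : ℂ) := by
  rw [uC_eq u ζ' (h := fun x => (φ x : ℂ)) (Complex.ofRealCLM.contDiff.comp hφ)]
  have e1 : mulSmooth ζ' (fun x => ((φ x : ℝ) : ℂ).re) (Complex.reCLM.contDiff.comp (Complex.ofRealCLM.contDiff.comp hφ)) =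
      mulSmooth ζ' φ hφ := by ext x; simp
  have e2 : mulSmooth ζ' (fun x => ((φ x : ℝ) : ℂ).im) (Complex.imCLM.contDiff.comp (Complex.ofRealCLM.contDiff.comp hφ)) = 0 := by
    ext x; simp
  rw [e1, e2, map_zero]
  simp

/-- **The hypothesis `hPu` of the key identity** from `ImageIsSmoothOn`. [folklore] -/
theorem hPu [FiniteDimensional ℝ E] [MeasurableSpace E] [BorelSpace E] (μ : Measure E) [IsLocallyFiniteMeasure μ]
    (eK : ι ≃ Fin K) (hXV : ∀ i, C.XV i = push T (X (eK.symm i)))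
    (hXV0 : C.XV0 = push T X₀) (hcV : C.cV = fun y => c (T.symm y))
    (hX₀ : ContDiff ℝ ∞ X₀) (hX : ∀ j, ContDiff ℝ ∞ (X j)) (hc : ContDiff ℝ ∞ c)
    (hΩ' : (Ω' : Set E) ⊆ T ⁻¹' ball C.y₀ C.δ)
    {u : 𝓓'(Ω', ℝ)} {U : Set E} (hU : IsOpen U) {f : E → ℝ} (hfU : ContinuousOn f U)
    (hfu : ∀ φ ψ : 𝓓(Ω', ℝ), tsupport (φ : E → ℝ) ⊆ U → (ψ : E → ℝ) = hormanderTranspose X₀ X c φ →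
      u ψ = ∫ x, f x * φ x ∂μ)
    {ζ ζ' : 𝓓(Ω', ℝ)} (hζU : tsupport (ζ : E → ℝ) ⊆ U) (hζ' : ∀ x ∈ tsupport (ζ : E → ℝ), ζ' x = 1)
    {g : E → ℂ} (hg : ContDiff ℝ ∞ g) :
    uC u ζ' ((C.xl T).PfC (mulC ζ g)) = ∫ x, ((f x * ζ x : ℝ) : ℂ) * g x ∂μ := by
  -- split `g` into real and imaginary parts
  set gr : E → ℝ := fun x => (g x).re with hgr
  set gi : E → ℝ := fun x => (g x).im with hgi
  have hgr_s : ContDiff ℝ ∞ gr := Complex.reCLM.contDiff.comp hg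
  have hgi_s : ContDiff ℝ ∞ gi := Complex.imCLM.contDiff.comp hg
  set φr : 𝓓(Ω', ℝ) := mulSmooth ζ gr hgr_s with hφr
  set φi : 𝓓(Ω', ℝ) := mulSmooth ζ gi hgi_s with hφi
  have esplit : mulC ζ g = fun x => (φr x : ℂ) + Complex.I * (φi x : ℂ) := by
    ext x
    simp only [mulC, hφr, hφi, mulSmooth_apply, hgr, hgi]
    push_cast
    linear_combination ((ζ x : ℝ) : ℂ) * (Complex.re_add_im (g x)).symm
  have hφr_s : ContDiff ℝ ∞ (fun x => (φr x : ℂ)) := Complex.ofRealCLM.contDiff.comp φr.contDiff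
  have hφi_s : ContDiff ℝ ∞ (fun x => (φi x : ℂ)) := Complex.ofRealCLM.contDiff.comp φi.contDiff
  rw [esplit, C.PfC_add T hφr_s (contDiff_const.mul hφi_s), C.PfC_const_mul T Complex.I hφi_s,
    uC_add u ζ' ((C.xl T).contDiff_PfC hφr_s) (contDiff_const.mul ((C.xl T).contDiff_PfC hφi_s)),
    uC_const_mul u ζ' Complex.I ((C.xl T).contDiff_PfC hφi_s)]
  -- each real piece: `uC u ζ' (PfC φ) = ∫ f φ`
  have hpiece : ∀ φ : 𝓓(Ω', ℝ), tsupport (φ : E → ℝ) ⊆ tsupport (ζ : E → ℝ) →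
      uC u ζ' ((C.xl T).PfC fun x => (φ x : ℂ)) = ((∫ x, f x * φ x ∂μ : ℝ) : ℂ) := by
    intro φ hφζ
    have hsupp : tsupport (φ : E → ℝ) ⊆ T ⁻¹' ball C.y₀ C.δ := (hφζ.trans ζ.tsupport_subset).trans hΩ'
    have ePf : ((C.xl T).PfC fun x => (φ x : ℂ)) = fun x => ((hormanderTranspose X₀ X c φ x : ℝ) : ℂ) :=
      funext fun x => C.PfC_ofReal T eK hXV hXV0 hcV hX₀ hX φ.contDiff hsupp x
    rw [ePf, uC_ofReal u ζ' (contDiff_hormanderTranspose hX₀ hX hc φ.contDiff)]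
    -- `ζ' ᵗPφ = ᵗPφ`
    have emul : mulSmooth ζ' (hormanderTranspose X₀ X c φ) (contDiff_hormanderTranspose hX₀ hX hc φ.contDiff) =
        hormanderTransposeTestFunction hX₀ hX hc φ := by
      ext x
      rw [mulSmooth_apply, coe_hormanderTransposeTestFunction]
      by_cases hx : x ∈ tsupport (hormanderTranspose X₀ X c φ)
      · rw [hζ' x (hφζ (tsupport_hormanderTranspose_subset X₀ X c φ hx)), one_mul]
      · rw [image_eq_zero_of_notMem_tsupport hx, mul_zero]
    rw [emul, hfu φ _ (hφζ.trans hζU) (coe_hormanderTransposeTestFunction hX₀ hX hc φ)]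
  have hsr : tsupport (φr : E → ℝ) ⊆ tsupport (ζ : E → ℝ) := tsupport_mul_subset_left
  have hsi : tsupport (φi : E → ℝ) ⊆ tsupport (ζ : E → ℝ) := tsupport_mul_subset_left
  rw [hpiece φr hsr, hpiece φi hsi]
  -- reassemble the integral
  have hfr : Integrable (fun x => f x * φr x) μ :=
    integrable_mul_of_tsupport_subset hU hfU φr.contDiff.continuous φr.hasCompactSupport (hsr.trans hζU)
  have hfi : Integrable (fun x => f x * φi x) μ :=
    integrable_mul_of_tsupport_subset hU hfU φi.contDiff.continuous φi.hasCompactSupport (hsi.trans hζU)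
  have e3 : (fun x => ((f x * ζ x : ℝ) : ℂ) * g x) =
      fun x => ((f x * φr x : ℝ) : ℂ) + Complex.I * ((f x * φi x : ℝ) : ℂ) := by
    ext x
    simp only [hφr, hφi, mulSmooth_apply, hgr, hgi]
    push_cast
    linear_combination ((f x : ℂ) * (ζ x : ℂ)) * (Complex.re_add_im (g x)).symm
  rw [e3, integral_add hfr.ofReal (hfi.ofReal.const_mul _), integral_const_mul,
    show (∫ a, ((f a * φr a : ℝ) : ℂ) ∂μ) = ((∫ a, f a * φr a ∂μ : ℝ) : ℂ) from integral_ofReal,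
    show (∫ a, ((f a * φi a : ℝ) : ℂ) ∂μ) = ((∫ a, f a * φi a ∂μ : ℝ) : ℂ) from integral_ofReal]

end Chart

end Literature.Analysis.Hypoelliptic
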